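import Mathlib
import Summits.ValiantsHypothesis.ValiantsHypothesis.Theorems.KPlusLogSqLawLiftingFiniteBaseChordMargin
import Summits.ValiantsHypothesis.ValiantsHypothesis.Theorems.KPlusLogSqLawLiftingLocalDescartesChain

/-!
# Patchworking at finite base, chord margins (part 4): PATCHWORKING IS EXACT AT POLYNOMIAL BASE — hidden slopes off the chords allowed

HONEST FRAMING.  Helper file toward the lifting crux `WeakLifting` (stmt-ValiantsHypothesis-19561; aside `Lifting`
stmt-ValiantsHypothesis-19772, registered stub `stub_liftThin`) of route `KPlusLogSqLaw` (cell `pub-symmetroid`, seat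
val-sym-lift-p1 g9, 2026-08-27).  A DESIGN-LEVEL statement about the patchworked pencil of ONE tropical design at finite base; nothing here
asserts `WeakLifting`, `TropicalB`, Conjecture B, `MatrixDescartes` (stmt-ValiantsHypothesis-18050) or anything about VP ≠ VNP, and nothing is
claimed about far-from-tropical pencils.

THEOREM (`card_posRoots_eq_card_alternating_of_chordMargin`).  Let `(d, v, ε)` be a design (`|ε| ≤ 1`), `b > 1`, `N = m!·K^m`, `D_max` a bound
for the present slopes, `6 N (D_max + 1) ≤ b^M`.  Let `P_0, …, P_r` (consecutive ones distinct) be dominant with margin `M` at integer slopes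
`θ_0 < ⋯ < θ_r`, spanning the present slopes (`D(P_0) ≤ D(q) ≤ D(P_r)` for every present `q`), and suppose that in every window the present
terms of slope strictly between `D(P_k)` and `D(P_{k+1})` lie below the CHORD of `(P_k, P_{k+1})` by `M`.  Then the number of distinct
positive zeros of `det F_b` EQUALS the alternation count `#{k : termSign P_k · termSign P_{k+1} < 0}`.
This is one-variable Viro patchworking made quantitative with a POLYNOMIAL base `(6 N (D_max+1))^{1/M}` (lift-p2's
`ExactPatchwork.card_posRoots_patch_eq_card_alternating`: `16 N (D+1) 4^D`, margin `1` at integer tie slopes) and with hidden slopes allowed as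
long as they stay `M` below the Newton polygon (this seat's `card_posRoots_eq_card_alternating_of_margin`: no hidden slopes).  PROOF: the
single-window theorem `card_roots_window_eq_of_chordMargin` (part 3) window by window; no zeros below `b^{θ_0}`, above `b^{θ_r}` or at the
`b^{θ_k}` (dominance); the windows are disjoint.  Also: the `IsDominant` (margin-`1`, base `6 N (D_max+1)`) form, and the LOWER half
`card_alternating_le_card_posRoots_of_margin` (≥ the alternation count along ANY margin-`M` chain with `N ≤ b^M`: no chord margin, no
spanning needed).  SANITY (non-vacuity): the `1 × 1` two-class design `1 − b⁻¹x` of the tree (`v₁₂`, `ε₁₂`) satisfies every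
hypothesis of the chord-margin window theorem with `M = 1`, `D_max = 1`, `N = 2`, and for `b ≥ 24` the window `(b⁰, b²)` carries exactly
one zero (`x = b`).  No `def`.  [folklore]
-/

set_option linter.dupNamespace false
set_option autoImplicit false

namespace Summit.ValiantsHypothesis.ValiantsHypothesis.Theorems.KPlusLogSqLaw.LocalDescartes

open Polynomial Finset
open scoped BigOperators
open Summit.ValiantsHypothesis.ValiantsHypothesis.Theorems.MatrixDescartes.Negative
  (patchMatrix tropWeight termSign IsDominant v₁₂ ε₁₂ p₁₂)
open Summit.ValiantsHypothesis.ValiantsHypothesis.Theorems.KPlusLogSqLaw.ExactPatchwork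
  (exists_present_of_mem_support mul_eval_pos_of_dominant card_alternating_le_card_posRoots)

variable {m K : ℕ}

/-- **PATCHWORKING IS EXACT AT POLYNOMIAL BASE (hidden slopes off the chords allowed).**  Under margin-`M` dominance of `P_0, …, P_r`
(consecutive ones distinct) at integer slopes `θ_0 < ⋯ < θ_r`, the spanning condition, the chord margins in every window and the base
condition `6 N (D_max + 1) ≤ b^M`, the patchworked pencil has EXACTLY `#{k : termSign P_k · termSign P_{k+1} < 0}` distinct positive zeros of
its determinant. [folklore] -/
theorem card_posRoots_eq_card_alternating_of_chordMargin (b : ℝ) (hb : 1 < b) (d : Fin K → ℕ)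
    (v ε : Fin m → Fin m → Fin K → ℤ) (hε : ∀ i j l, (ε i j l).natAbs ≤ 1) (M Dmax : ℕ)
    (hDmax : ∀ q : Equiv.Perm (Fin m) × (Fin m → Fin K), termSign ε q ≠ 0 → (∑ i, d (q.2 i)) ≤ Dmax)
    (hbase : 6 * (Fintype.card (Equiv.Perm (Fin m) × (Fin m → Fin K)) : ℝ) * ((Dmax : ℝ) + 1) ≤ b ^ M)
    (r : ℕ) (θ : Fin (r + 1) → ℤ) (hθ : StrictMono θ) (P : Fin (r + 1) → Equiv.Perm (Fin m) × (Fin m → Fin K))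
    (hP : ∀ k, termSign ε (P k) ≠ 0) (hne : ∀ k : Fin r, P k.castSucc ≠ P k.succ)
    (hmar : ∀ k q, q ≠ P k → termSign ε q ≠ 0 → tropWeight d v (θ k) q + M ≤ tropWeight d v (θ k) (P k))
    (hchord : ∀ (k : Fin r) (q : Equiv.Perm (Fin m) × (Fin m → Fin K)), termSign ε q ≠ 0 →
      (∑ i, d ((P k.castSucc).2 i)) < (∑ i, d (q.2 i)) → (∑ i, d (q.2 i)) < (∑ i, d ((P k.succ).2 i)) →
      (∑ i, v ((P k.castSucc).1 i) i ((P k.castSucc).2 i))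
          * (((∑ i, d ((P k.succ).2 i) : ℕ) : ℤ) - ((∑ i, d (q.2 i) : ℕ) : ℤ))
        + (∑ i, v ((P k.succ).1 i) i ((P k.succ).2 i))
          * (((∑ i, d (q.2 i) : ℕ) : ℤ) - ((∑ i, d ((P k.castSucc).2 i) : ℕ) : ℤ))
        + (M : ℤ) * (((∑ i, d ((P k.succ).2 i) : ℕ) : ℤ) - ((∑ i, d ((P k.castSucc).2 i) : ℕ) : ℤ))
        ≤ (∑ i, v (q.1 i) i (q.2 i)) * (((∑ i, d ((P k.succ).2 i) : ℕ) : ℤ) - ((∑ i, d ((P k.castSucc).2 i) : ℕ) : ℤ)))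
    (hrange : ∀ q : Equiv.Perm (Fin m) × (Fin m → Fin K), termSign ε q ≠ 0 →
      (∑ i, d ((P 0).2 i)) ≤ (∑ i, d (q.2 i)) ∧ (∑ i, d (q.2 i)) ≤ ∑ i, d ((P (Fin.last r)).2 i)) :
    (((∑ l, (X : ℝ[X]) ^ d l • (patchMatrix b v ε l).map C).det).roots.toFinset.filter (fun t => 0 < t)).card
      = (Finset.univ.filter (fun k : Fin r => termSign ε (P k.castSucc) * termSign ε (P k.succ) < 0)).card := by
  classical
  have hb0 : 0 < b := lt_trans one_pos hb
  set f := ((∑ l, (X : ℝ[X]) ^ d l • (patchMatrix b v ε l).map C).det) with hf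
  set N : ℕ := Fintype.card (Equiv.Perm (Fin m) × (Fin m → Fin K)) with hNdef
  have hN1 : (1 : ℝ) ≤ N := by exact_mod_cast Fintype.card_pos_iff.mpr ⟨P 0⟩
  have hNle : (N : ℝ) ≤ b ^ M := by
    have : (Dmax : ℝ) + 1 ≥ 1 := by have := Nat.cast_nonneg (α := ℝ) Dmax; linarith
    nlinarith
  -- dominance points and monomial dominance there
  set a : Fin (r + 1) → ℝ := fun k => b ^ θ k with ha
  have hamono : StrictMono a := fun i j hij => zpow_lt_zpow_right₀ hb (hθ hij)
  have ha0 : 0 < a 0 := zpow_pos hb0 _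
  have hapos : ∀ k, 0 < a k := fun k => zpow_pos hb0 _
  have hdom : ∀ k, ∑ s ∈ f.support.erase (∑ i, d ((P k).2 i)), |f.coeff s| * a k ^ s
      < |f.coeff (∑ i, d ((P k).2 i))| * a k ^ (∑ i, d ((P k).2 i)) :=
    fun k => monomial_dominant_of_margin b hb d v ε hε (θ k) M (P k) (hP k) (hmar k) (by rw [← hNdef]; exact hNle)
  have hcu : ∀ k, f.coeff (∑ i, d ((P k).2 i)) ≠ 0 := fun k => coeff_ne_zero_of_dominant f (hapos k) (hdom k)
  have hf0 : f ≠ 0 := fun h => hcu 0 (by rw [h, Polynomial.coeff_zero])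
  -- the window sets
  set S := f.roots.toFinset.filter (fun t => 0 < t) with hS
  set W : Fin r → Finset ℝ := fun k => f.roots.toFinset.filter (fun x => b ^ θ k.castSucc < x ∧ x < b ^ θ k.succ) with hW
  -- each window is exact
  have hWk : ∀ k : Fin r, (W k).card = if termSign ε (P k.castSucc) * termSign ε (P k.succ) < 0 then 1 else 0 := by
    intro k
    exact card_roots_window_eq_of_chordMargin b hb d v ε hε M Dmax hDmax hbase (hθ Fin.castSucc_lt_succ) (P k.castSucc)
      (P k.succ) (hne k) (hP _) (hP _) (hmar _) (hmar _) (hchord k)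
  -- the positive zeros are exactly the union of the windows
  have hcover : S = Finset.univ.biUnion W := by
    ext t
    constructor
    · intro ht
      rw [Finset.mem_filter] at ht
      have hroot : f.eval t = 0 := by
        have := ht.1
        rw [Multiset.mem_toFinset, Polynomial.mem_roots hf0] at this
        exact this
      rcases root_trichotomy_of_chain f r (fun k => ∑ i, d ((P k).2 i)) a hamono ha0 hdom hroot with h1 | ⟨k, hk1, hk2⟩ | h3
      · exfalso
        refine eval_ne_zero_of_dominant_of_forall_le f (fun s hs => ?_) (hdom 0) ht.2 h1.le hroot
        obtain ⟨q, hq, hqs⟩ := exists_present_of_mem_support b hb0 d v ε hs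
        rw [← hqs]; exact (hrange q hq).1
      · rw [Finset.mem_biUnion]
        exact ⟨k, Finset.mem_univ _, Finset.mem_filter.mpr ⟨ht.1, hk1, hk2⟩⟩
      · exfalso
        refine eval_ne_zero_of_dominant_of_forall_ge f (hapos _) (fun s hs => ?_) (hdom (Fin.last r)) h3.le hroot
        obtain ⟨q, hq, hqs⟩ := exists_present_of_mem_support b hb0 d v ε hs
        rw [← hqs]; exact (hrange q hq).2
    · intro ht
      rw [Finset.mem_biUnion] at ht
      obtain ⟨k, _, hk⟩ := ht
      rw [Finset.mem_filter] at hk ⊢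
      exact ⟨hk.1, lt_trans (hapos k.castSucc) hk.2.1⟩
  -- the windows are pairwise disjoint
  have hdisj : ∀ k ∈ (Finset.univ : Finset (Fin r)), ∀ k' ∈ (Finset.univ : Finset (Fin r)), k ≠ k' → Disjoint (W k) (W k') := by
    intro k _ k' _ hkk'
    rw [Finset.disjoint_left]
    intro t ht ht'
    rw [Finset.mem_filter] at ht ht'
    rcases lt_or_gt_of_ne hkk' with hlt | hlt
    · have hle : a k.succ ≤ a k'.castSucc := hamono.monotone (Fin.succ_le_castSucc_iff.mpr hlt)
      have : t < t := lt_of_lt_of_le ht.2.2 (hle.trans ht'.2.1.le)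
      exact lt_irrefl _ this
    · have hle : a k'.succ ≤ a k.castSucc := hamono.monotone (Fin.succ_le_castSucc_iff.mpr hlt)
      have : t < t := lt_of_lt_of_le ht'.2.2 (hle.trans ht.2.1.le)
      exact lt_irrefl _ this
  rw [hcover, Finset.card_biUnion hdisj, Finset.card_filter]
  exact Finset.sum_congr rfl fun k _ => hWk k

/-- **PATCHWORKING IS EXACT AT BASE `6 N (D_max + 1)` FOR THE TREE'S DOMINANT CHAINS** (margin `1`, the `TropRow` currency): if
`P_0, …, P_r` (consecutive ones distinct) are `IsDominant` at integer slopes `θ_0 < ⋯ < θ_r`, span the present slopes, and in every window the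
hidden terms lie `≥ 1` below the chord (`V(P_k)(D_{k+1} − D_q) + V(P_{k+1})(D_q − D_k) + (D_{k+1} − D_k) ≤ V(q)(D_{k+1} − D_k)`), then for every
base `b ≥ 6 N (D_max + 1)` the patchworked pencil has exactly `#{k : termSign P_k · termSign P_{k+1} < 0}` distinct positive zeros of its
determinant. [folklore] -/
theorem card_posRoots_eq_card_alternating_of_chordMargin_isDominant (b : ℝ) (hb : 1 < b) (d : Fin K → ℕ)
    (v ε : Fin m → Fin m → Fin K → ℤ) (hε : ∀ i j l, (ε i j l).natAbs ≤ 1) (Dmax : ℕ)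
    (hDmax : ∀ q : Equiv.Perm (Fin m) × (Fin m → Fin K), termSign ε q ≠ 0 → (∑ i, d (q.2 i)) ≤ Dmax)
    (hbase : 6 * (Fintype.card (Equiv.Perm (Fin m) × (Fin m → Fin K)) : ℝ) * ((Dmax : ℝ) + 1) ≤ b)
    (r : ℕ) (θ : Fin (r + 1) → ℤ) (hθ : StrictMono θ) (P : Fin (r + 1) → Equiv.Perm (Fin m) × (Fin m → Fin K))
    (hP : ∀ k, IsDominant d v ε (θ k) (P k)) (hne : ∀ k : Fin r, P k.castSucc ≠ P k.succ)
    (hchord : ∀ (k : Fin r) (q : Equiv.Perm (Fin m) × (Fin m → Fin K)), termSign ε q ≠ 0 →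
      (∑ i, d ((P k.castSucc).2 i)) < (∑ i, d (q.2 i)) → (∑ i, d (q.2 i)) < (∑ i, d ((P k.succ).2 i)) →
      (∑ i, v ((P k.castSucc).1 i) i ((P k.castSucc).2 i))
          * (((∑ i, d ((P k.succ).2 i) : ℕ) : ℤ) - ((∑ i, d (q.2 i) : ℕ) : ℤ))
        + (∑ i, v ((P k.succ).1 i) i ((P k.succ).2 i))
          * (((∑ i, d (q.2 i) : ℕ) : ℤ) - ((∑ i, d ((P k.castSucc).2 i) : ℕ) : ℤ))
        + (((∑ i, d ((P k.succ).2 i) : ℕ) : ℤ) - ((∑ i, d ((P k.castSucc).2 i) : ℕ) : ℤ))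
        ≤ (∑ i, v (q.1 i) i (q.2 i)) * (((∑ i, d ((P k.succ).2 i) : ℕ) : ℤ) - ((∑ i, d ((P k.castSucc).2 i) : ℕ) : ℤ)))
    (hrange : ∀ q : Equiv.Perm (Fin m) × (Fin m → Fin K), termSign ε q ≠ 0 →
      (∑ i, d ((P 0).2 i)) ≤ (∑ i, d (q.2 i)) ∧ (∑ i, d (q.2 i)) ≤ ∑ i, d ((P (Fin.last r)).2 i)) :
    (((∑ l, (X : ℝ[X]) ^ d l • (patchMatrix b v ε l).map C).det).roots.toFinset.filter (fun t => 0 < t)).card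
      = (Finset.univ.filter (fun k : Fin r => termSign ε (P k.castSucc) * termSign ε (P k.succ) < 0)).card := by
  refine card_posRoots_eq_card_alternating_of_chordMargin b hb d v ε hε 1 Dmax hDmax (by rw [pow_one]; exact hbase) r θ hθ P
    (fun k => (hP k).1) hne (fun k => (margin_one_of_isDominant d v ε (θ k) (P k) (hP k)).2) (fun k q hq h1 h2 => ?_) hrange
  have := hchord k q hq h1 h2
  push_cast at this ⊢
  linarith

/-- **The lower half needs no chord margin and no spanning**: along any margin-`M` dominant chain at integer slopes `θ_0 < ⋯ < θ_r` with
`N ≤ b^M`, the patchworked pencil has AT LEAST `#{k : termSign P_k · termSign P_{k+1} < 0}` distinct positive zeros (one in each alternating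
window, by intermediate values at the monomial-dominance points; the tree's `le_card_posRoots_patch` is the case `M = 1`, `b = N + 1`, all
windows alternating). [folklore] -/
theorem card_alternating_le_card_posRoots_of_margin (b : ℝ) (hb : 1 < b) (d : Fin K → ℕ)
    (v ε : Fin m → Fin m → Fin K → ℤ) (hε : ∀ i j l, (ε i j l).natAbs ≤ 1) (M : ℕ)
    (hN : (Fintype.card (Equiv.Perm (Fin m) × (Fin m → Fin K)) : ℝ) ≤ b ^ M)
    (r : ℕ) (θ : Fin (r + 1) → ℤ) (hθ : StrictMono θ) (P : Fin (r + 1) → Equiv.Perm (Fin m) × (Fin m → Fin K))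
    (hP : ∀ k, termSign ε (P k) ≠ 0)
    (hmar : ∀ k q, q ≠ P k → termSign ε q ≠ 0 → tropWeight d v (θ k) q + M ≤ tropWeight d v (θ k) (P k)) :
    (Finset.univ.filter (fun k : Fin r => termSign ε (P k.castSucc) * termSign ε (P k.succ) < 0)).card
      ≤ (((∑ l, (X : ℝ[X]) ^ d l • (patchMatrix b v ε l).map C).det).roots.toFinset.filter (fun t => 0 < t)).card := by
  classical
  have hb0 : 0 < b := lt_trans one_pos hb
  set f := ((∑ l, (X : ℝ[X]) ^ d l • (patchMatrix b v ε l).map C).det) with hf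
  have hdom : ∀ k, ∑ s ∈ f.support.erase (∑ i, d ((P k).2 i)), |f.coeff s| * (b ^ θ k) ^ s
      < |f.coeff (∑ i, d ((P k).2 i))| * (b ^ θ k) ^ (∑ i, d ((P k).2 i)) :=
    fun k => monomial_dominant_of_margin b hb d v ε hε (θ k) M (P k) (hP k) (hmar k) hN
  have hsign : ∀ k, 0 < (termSign ε (P k) : ℝ) * f.coeff (∑ i, d ((P k).2 i)) :=
    fun k => termSign_mul_coeff_pos_of_margin b hb d v ε hε (θ k) M (P k) (hP k) (hmar k) hN
  have h := card_alternating_le_card_posRoots f r (fun k => ∑ i, d ((P k).2 i)) (fun k => b ^ θ k.castSucc)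
    (fun k => b ^ θ k.succ) (fun k => zpow_pos hb0 _) (fun k => (zpow_lt_zpow_right₀ hb (hθ Fin.castSucc_lt_succ)).le)
    (fun k k' hkk' => zpow_le_zpow_right₀ hb.le (hθ.monotone (Fin.succ_le_castSucc_iff.mpr hkk'))) (fun k => hdom _) (fun k => hdom _)
  refine le_trans (le_of_eq ?_) h
  refine Finset.card_bij (fun k _ => k) (fun k hk => ?_) (fun _ _ _ _ h => h) (fun k hk => ⟨k, ?_, rfl⟩)
  · rw [Finset.mem_filter] at hk ⊢
    refine ⟨hk.1, ?_⟩
    have key := mul_pos (hsign k.castSucc) (hsign k.succ)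
    have h' : (termSign ε (P k.castSucc) : ℝ) * (termSign ε (P k.succ) : ℝ) < 0 := by exact_mod_cast hk.2
    by_contra hge; push Not at hge
    nlinarith [mul_nonpos_of_nonpos_of_nonneg h'.le hge]
  · rw [Finset.mem_filter] at hk ⊢
    refine ⟨hk.1, ?_⟩
    have key := mul_pos (hsign k.castSucc) (hsign k.succ)
    have : (termSign ε (P k.castSucc) : ℝ) * (termSign ε (P k.succ) : ℝ) < 0 := by
      by_contra hge; push Not at hge
      nlinarith [mul_nonpos_of_nonneg_of_nonpos hge hk.2.le]
    exact_mod_cast this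

/-! ## Sanity check: the hypotheses are not vacuous -/

/-- the Leibniz terms of the `1 × 1` two-class sanity design are `p₁₂ 0` and `p₁₂ 1`. -/
theorem sanity_term_cases (q : Equiv.Perm (Fin 1) × (Fin 1 → Fin 2)) : q = p₁₂ 0 ∨ q = p₁₂ 1 := by
  obtain ⟨σ, f⟩ := q
  have hσ : σ = 1 := Subsingleton.elim _ _
  subst hσ
  have hf : f = fun _ => f 0 := by funext i; rw [Subsingleton.elim i 0]
  have h2 : ∀ x : Fin 2, x = 0 ∨ x = 1 := by decide
  rcases h2 (f 0) with h | h
  · left; rw [hf, h]; rfl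
  · right; rw [hf, h]; rfl

/-- **Sanity check (non-vacuity of the chord-margin hypotheses).**  For the `1 × 1` two-class design `1 − b⁻¹ x` (the tree's
`v₁₂`, `ε₁₂`, exponents `(0, 1)`): the class-`0` term is dominant with margin `1` at the slope `0`, the class-`1` term at the slope `2`,
`D_max = 1`, `N = 2`, no hidden slope; so for every base `b ≥ 24` the window `(b⁰, b²)` carries EXACTLY one zero of the determinant
(indeed `x = b`). -/
example (b : ℝ) (hb : 24 ≤ b) :
    (((∑ l, (X : ℝ[X]) ^ (![0, 1] : Fin 2 → ℕ) l • (patchMatrix b v₁₂ ε₁₂ l).map C).det).roots.toFinset.filter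
        (fun x => b ^ (0 : ℤ) < x ∧ x < b ^ (2 : ℤ))).card = 1 := by
  have hb1 : (1 : ℝ) < b := by linarith
  have hcard : (Fintype.card (Equiv.Perm (Fin 1) × (Fin 1 → Fin 2)) : ℝ) = 2 := by
    norm_num [Fintype.card_prod, Fintype.card_perm, Fintype.card_fun]
  have hd : ∀ x : Fin 2, (![0, 1] : Fin 2 → ℕ) x ≤ 1 := by decide
  have hslope : ∀ q : Equiv.Perm (Fin 1) × (Fin 1 → Fin 2), (∑ i, (![0, 1] : Fin 2 → ℕ) (q.2 i)) ≤ 1 := by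
    intro q
    rw [Fin.sum_univ_one]
    exact hd _
  have h := card_roots_window_eq_of_chordMargin b hb1 ![0, 1] v₁₂ ε₁₂ (by decide) 1 1 (fun q _ => hslope q)
    (by rw [hcard, pow_one]; norm_num; linarith) (θ₁ := 0) (θ₂ := 2) (by norm_num) (p₁₂ 0) (p₁₂ 1) (by decide) (by decide) (by decide)
    ?_ ?_ ?_
  · rw [h]; decide
  · intro q hq _
    rcases sanity_term_cases q with rfl | rfl
    · exact absurd rfl hq
    · decide
  · intro q hq _
    rcases sanity_term_cases q with rfl | rfl
    · decide
    · exact absurd rfl hq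
  · intro q _ h1 h2
    exfalso
    rcases sanity_term_cases q with rfl | rfl
    · revert h1; decide
    · revert h2; decide

end Summit.ValiantsHypothesis.ValiantsHypothesis.Theorems.KPlusLogSqLaw.LocalDescartes
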